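import Summits.AnomalousDissipation.AnomalousDissipation.Theorems.SolenoidalFractalHomogenisationLagrangianStepVmodFsPhaseWindow
import Summits.AnomalousDissipation.AnomalousDissipation.Theorems.SolenoidalFractalHomogenisationLagrangianStepVmodHighGeneral
import HarnessLib

/-!
# K1L_D (stmt-AnomalousDissipation-27980): (V_mod) flat stage, block (fs) — ROW H: slow tests on HIGH classes, windows at carrier phase 0,
# `ν < νh` — the W7 clause pays, and the bound DECAYS like `exp(−cK·ν·τ)` (rows «H / high / τ ≥ P» of the certifier's table, block (fs))
(helper; `--supports 27980 --as helper`; prover ad-k1loc-p3 g10; on top of `…VmodFsPhaseWindow` (p714354: the (fs) assembly pattern) and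
`…VmodHighGeneral` (p716561: `VmodGen.norm_apply_le_of_highLabelDecay_general`, tool T-H on general data).)

Fast datum `x`, slow test `ζ` supported on HIGH slow labels `L ≤ ‖ℓ‖ (≤ n/4)`, window `[s,t]` with `cellField(s+·) = cellField` beyond the fast
saturation time, `ν < νh`, `n·ν ≤ Kb·L`, and ONE instance `HighLabelDecayW W M hM lo hi Λ β νh Kb CK cK` of the W7 clause.  Per slow label `ℓ`
the fast members of the class pair of `ℓ` carry no Bloch label of norm `< L` (a label `ℓ'` of that class other than `±ℓ` has `‖ℓ'‖ ≥ n − ‖ℓ‖ ≥ ‖ℓ‖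
≥ L`), so T-H gives the UNIFORM leak `‖𝓕(U v)(ℓ)‖ ≤ ‖U v‖ ≤ √CK·e^{−cK·ν·(t−s)}·‖v‖` (`norm_fc_le_of_highClass_fast`); the slow dissipation weight of
every high label is `≥ d_L := 1 − exp(−8π²·loT·L²·(t−s))`; `abs_inner_sub_le_sqrt_of_fast_modewise` (p713117) and the currency then give

  `|⟪U s t x − T s t x, ζ⟫| ≤ 2·(√CK·e^{−cK·ν·(t−s)} / √d_L) · √(lossFwd (T s t) x) · √(lossAdj (T s t) ζ)`   (`fs_pairing_le_of_phase_window_high`).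

For `t − s ≥ P = M·W.period/ν` the right side is `≤ 2√CK·ρ_H^{(t−s)/P}/√(1 − e^{−2θ_L})` with `ρ_H = e^{−cK·M·W.period} < 1` — it DECAYS, which
is what the `(min 1 (P/(t−s)))^σ″` cap of `BlockBound` asks on long windows.  `sorry`-free; NOT a proof of (fs), of the stub, of K1L_D or of
AD; rung F-D1.A0.
-/

set_option linter.dupNamespace false

noncomputable section

namespace Summit.AnomalousDissipation.AnomalousDissipation.Theorems.SolenoidalFractalHomogenisation.LagrangianStep.VmodFlat

open Literature.Analysis Literature.Analysis.FluidPDE Literature.Analysis.FunctionSpaces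
open MeasureTheory Set Filter UnitAddTorus
open scoped ENNReal NNReal InnerProductSpace
open Summit.AnomalousDissipation.AnomalousDissipation.Theorems.SolenoidalFractalHomogenisation.LagrangianStep.CellClauseMod
open Summit.AnomalousDissipation.AnomalousDissipation.Theorems.SolenoidalFractalHomogenisation.LagrangianStep.LossCurrency
open Summit.AnomalousDissipation.AnomalousDissipation.Theorems.SolenoidalFractalHomogenisation.RealisedQuasiStaticCellLaw
  (isSmooth_cell isDivFree_cell memLp_top_stLift_cell)
open Summit.AnomalousDissipation.AnomalousDissipation.Theorems.SolenoidalFractalHomogenisation.LagrangianStep.CellChain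
  (norm_latticeVec_ge_of_classPair_ne)

/-! ## §1 Class pairs in divisibility form -/

/-- Divisibility form ⇒ lattice form: `n ∣ a i − b i` for all `i` gives `a = b + n•z`. [folklore] -/
theorem exists_eq_add_zsmul_of_dvd {n : ℕ} {a b : Fin 3 → ℤ} (h : ∀ i, (n:ℤ) ∣ a i - b i) :
    ∃ z : Fin 3 → ℤ, a = b + (n : ℤ) • z := by
  refine ⟨fun i => (a i - b i) / n, funext fun i => ?_⟩
  have hi := Int.ediv_mul_cancel (h i)
  simp only [Pi.add_apply, Pi.smul_apply, smul_eq_mul]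
  linarith [hi, mul_comm ((a i - b i) / n) (n:ℤ)]

/-- **A fast member of the class pair of a slow label `ℓ` with `L ≤ ‖ℓ‖`, `2‖ℓ‖ < n` carries no Bloch label of norm `< L`.**  If `k' = ℓ' + n•z`
with `‖ℓ'‖ < L` and `k'` lies in `(±ℓ + nℤ³)`, then so does `ℓ'`, `ℓ' ≠ ±ℓ` by norms, and `‖ℓ'‖ ≥ n − ‖ℓ‖ > ‖ℓ‖ ≥ L` — absurd. [folklore] -/
theorem not_classPair_of_lowLabel {n : ℕ} {ℓ k' : Fin 3 → ℤ} {L : ℝ} (hℓL : L ≤ ‖Torus.latticeVec ℓ‖) (hℓn : 2 * ‖Torus.latticeVec ℓ‖ < n)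
    (hk' : ∃ ℓ' z : Fin 3 → ℤ, ‖Torus.latticeVec ℓ'‖ < L ∧ k' = ℓ' + (n : ℤ) • z) :
    ¬ ((∀ i, (n:ℤ) ∣ k' i - ℓ i) ∨ (∀ i, (n:ℤ) ∣ k' i + ℓ i)) := by
  rintro hcp
  obtain ⟨ℓ', z, hℓ'L, hk'eq⟩ := hk'
  have hdiff : ∀ i, k' i - ℓ' i = (n:ℤ) * z i := fun i => by
    have := congrFun hk'eq i; simp only [Pi.add_apply, Pi.smul_apply, smul_eq_mul] at this; linarith
  have hcl : (∃ z' : Fin 3 → ℤ, ℓ' = ℓ + (n : ℤ) • z') ∨ (∃ z' : Fin 3 → ℤ, ℓ' = -ℓ + (n : ℤ) • z') := by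
    rcases hcp with h | h
    · refine Or.inl (exists_eq_add_zsmul_of_dvd fun i => ?_)
      have h1 : ℓ' i - ℓ i = (k' i - ℓ i) - (n:ℤ) * z i := by linarith [hdiff i]
      rw [h1]; exact dvd_sub (h i) (dvd_mul_right _ _)
    · refine Or.inr (exists_eq_add_zsmul_of_dvd fun i => ?_)
      have h1 : ℓ' i - (-ℓ) i = (k' i + ℓ i) - (n:ℤ) * z i := by simp only [Pi.neg_apply]; linarith [hdiff i]
      rw [h1]; exact dvd_sub (h i) (dvd_mul_right _ _)
  by_cases h2 : ℓ' = ℓ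
  · rw [h2] at hℓ'L; linarith
  · by_cases h3 : ℓ' = -ℓ
    · rw [h3, Torus.latticeVec_neg, norm_neg] at hℓ'L; linarith
    · have hge := norm_latticeVec_ge_of_classPair_ne hcl h2 h3
      linarith

/-! ## §2 The uniform leak on high classes (tool T-H, per label) -/

/-- **Per-label T-H leak.**  Window at carrier phase 0, `ν < νh`, `n·ν ≤ Kb·L`, slow label `ℓ` with `L ≤ ‖ℓ‖`, `2‖ℓ‖ < n`; a weakly divergence-free
`v` supported on the class pair of `ℓ` off `±ℓ` (a fast member): `‖𝓕(U s t v)(ℓ)‖ ≤ √CK·exp(−cK·ν·(t−s))·‖v‖`. -/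
theorem norm_fc_le_of_highClass_fast {k : ℕ} (W : LatticeShear.LatticeWord k) (M : ℝ) (hM : 0 < M) {lo hi Λ β νh Kb CK cK : ℝ}
    (hH : HighLabelDecayW W M hM lo hi Λ β νh Kb CK cK) (hlo : 0 < lo) (hhi : 0 ≤ hi) (hΛ : 1 ≤ Λ) (hCK : 0 ≤ CK)
    {ν : ℝ} (hν : ν ∈ Set.Ioo 0 νh) {n : ℕ} (hn : 1 ≤ n) {𝔸 : Torus.Visc4 (Fin 3)} (hodd : Torus.OddSmall 𝔸 (ν * β))
    (hwin : ∃ lam ∈ Set.Icc (1:ℝ) Λ, Torus.NearIso 𝔸 (ν * (lo / lam)) (ν * (hi * lam)))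
    {Tw : ℝ} {U : ℝ → ℝ → (V2 →L[ℝ] V2)} (hU : Torus.IsPropagator Tw (cellField W M hM ν hν.1 n) ((1 / (n:ℝ) ^ 2) • 𝔸) U)
    {s t : ℝ} (hs : 0 ≤ s) (hst : s ≤ t) (htT : t ≤ Tw) (hsT : s < Tw)
    (hphase : ∀ τ, cellField W M hM ν hν.1 n (s + τ) = cellField W M hM ν hν.1 n τ)
    {L : ℝ} (hL : 0 < L) (hKL : (n : ℝ) * ν ≤ Kb * L)
    {ℓ : Fin 3 → ℤ} (hℓL : L ≤ ‖Torus.latticeVec ℓ‖) (hℓn : 2 * ‖Torus.latticeVec ℓ‖ < n)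
    (v : V2) (hv : v ∈ Torus.divFreeL2 (Fin 3))
    (hvs : ∀ k', ¬ ((∀ i, (n:ℤ) ∣ k' i - ℓ i) ∨ (∀ i, (n:ℤ) ∣ k' i + ℓ i)) → fc v k' = 0) :
    ‖fc (U s t v) ℓ‖ ≤ Real.sqrt CK * Real.exp (-(cK * ν * (t - s))) * ‖v‖ := by
  have hfs : ∀ k' : Fin 3 → ℤ, (∃ ℓ' z : Fin 3 → ℤ, ‖Torus.latticeVec ℓ'‖ < L ∧ k' = ℓ' + (n : ℤ) • z) → fc v k' = 0 :=
    fun k' hk' => hvs k' (not_classPair_of_lowLabel hℓL hℓn hk')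
  have hTH := VmodGen.norm_apply_le_of_highLabelDecay_general W M hM hH hlo hhi hΛ hCK hν hn hodd hwin hU hs hst htT hsT hphase hL hKL v hv hfs
  have hB := sum_norm_sq_fcoeff_le {ℓ} (U s t v)
  rw [Finset.sum_singleton] at hB
  have h2 : ‖fc (U s t v) ℓ‖ ≤ ‖U s t v‖ := by
    calc ‖fc (U s t v) ℓ‖ = Real.sqrt (‖fc (U s t v) ℓ‖ ^ 2) := (Real.sqrt_sq (norm_nonneg _)).symm
      _ ≤ Real.sqrt (‖U s t v‖ ^ 2) := Real.sqrt_le_sqrt hB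
      _ = ‖U s t v‖ := Real.sqrt_sq (norm_nonneg _)
  exact h2.trans hTH

/-! ## §3 Row H of block (fs) in the loss currency -/

set_option maxHeartbeats 1600000 in
/-- **(fs), ROW H (high slow classes, phase-0 window beyond the fast saturation time, `ν < νh`).**  See the module docstring.  The constant
`2·√CK·exp(−cK·ν·(t−s))/√(1 − exp(−8π²·loT·L²·(t−s)))` decays exponentially in `(t−s)/P` once `t − s ≥ P`. -/
theorem fs_pairing_le_of_phase_window_high {k : ℕ} (W : LatticeShear.LatticeWord k) (M : ℝ) (hM : 0 < M) {c : ℝ} (hc : 0 < c)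
    (Φ : ℝ → Torus.Visc4 (Fin 3) → Torus.Visc4 (Fin 3)) {lo hi Λ β ν₀ K : ℝ}
    (hlo : 0 < lo) (hhi : 1 ≤ hi) (hΛ : 1 < Λ) (hK : 0 < K)
    {νh Kb CK cK : ℝ} (hH : HighLabelDecayW W M hM lo hi Λ β νh Kb CK cK) (hCK : 0 ≤ CK)
    {ν : ℝ} (hν : ν ∈ Set.Ioo 0 ν₀) (hνh : ν < νh) {n : ℕ} (hn : (⌈K / ν⌉₊ : ℝ) ≤ n) {𝔸 : Torus.Visc4 (Fin 3)}
    (hodd : Torus.OddSmall 𝔸 (ν * β)) (hwin : ∃ lam ∈ Set.Icc (1:ℝ) Λ, Torus.NearIso 𝔸 (ν * (lo / lam)) (ν * (hi * lam)))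
    (hΦw : ∃ lam ∈ Set.Icc (1:ℝ) Λ, Torus.NearIso (Φ ν ((1 / ν) • 𝔸)) (lo / lam) (hi * lam))
    {Tw : ℝ} {U T : ℝ → ℝ → (V2 →L[ℝ] V2)}
    (hU : Torus.IsPropagator Tw (cellField W M hM ν hν.1 n) ((1 / (n:ℝ) ^ 2) • 𝔸) U)
    (hT : Torus.IsPropagator Tw (fun _ _ => 0) ((1 / (n:ℝ) ^ 2) • (𝔸 + (c / ν) • Φ ν ((1 / ν) • 𝔸))) T)
    {s t : ℝ} (hs : 0 ≤ s) (hst : s < t) (htT : t ≤ Tw)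
    (hphase : ∀ τ, cellField W M hM ν hν.1 n (s + τ) = cellField W M hM ν hν.1 n τ)
    {L : ℝ} (hL : 0 < L) (hKL : (n : ℝ) * ν ≤ Kb * L)
    (x ζ : V2) (hx : IsFast n x) (hζ : IsSlow n ζ) (hζH : ∀ k', ‖Torus.latticeVec k'‖ < L → fc ζ k' = 0)
    (hsat : 1 ≤ 8 * Real.pi ^ 2 * loT lo Λ c ν n * ((n / 4 : ℕ) : ℝ) ^ 2 * (t - s)) :
    |⟪U s t x - T s t x, ζ⟫_ℝ|
      ≤ 2 * (Real.sqrt CK * Real.exp (-(cK * ν * (t - s)))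
            / Real.sqrt (1 - Real.exp (-(8 * Real.pi ^ 2 * loT lo Λ c ν n * L ^ 2 * (t - s)))))
          * Real.sqrt (lossFwd (T s t) x) * Real.sqrt (lossAdj (T s t) ζ) := by
  classical
  have hn1 : (1:ℝ) ≤ n := by
    have h1 : (1:ℝ) ≤ ⌈K / ν⌉₊ := by
      have : 0 < K / ν := div_pos hK hν.1
      exact_mod_cast Nat.one_le_iff_ne_zero.2 (Nat.pos_iff_ne_zero.1 (Nat.ceil_pos.2 this))
    exact h1.trans hn
  have hnpos : 0 < n := by exact_mod_cast (show (0:ℝ) < n by linarith)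
  have hn1' : 1 ≤ n := hnpos
  have hn0 : (0:ℝ) < n := by exact_mod_cast hnpos
  have hν0 : 0 < ν := hν.1
  have hΛ0 : 0 < Λ := by linarith
  have hΛ1 : 1 ≤ Λ := hΛ.le
  have hhi0 : 0 ≤ hi := by linarith
  have hts : 0 < t - s := sub_pos.2 hst
  have hsT : s < Tw := lt_of_lt_of_le hst htT
  have hνI : ν ∈ Set.Ioo 0 νh := ⟨hν0, hνh⟩
  set N₄ : ℕ := n / 4 with hN₄
  set S : Finset (Fin 3 → ℤ) := ((Torus.freqBall (d := Fin 3) (n / 4)).erase 0).filter (fun ℓ => L ≤ ‖Torus.latticeVec ℓ‖) with hS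
  have hSsub : ∀ ℓ ∈ S, ℓ ∈ (Torus.freqBall (d := Fin 3) (n / 4)).erase 0 := fun ℓ hℓ => (Finset.mem_filter.1 hℓ).1
  have hSL : ∀ ℓ ∈ S, L ≤ ‖Torus.latticeVec ℓ‖ := fun ℓ hℓ => (Finset.mem_filter.1 hℓ).2
  have hLN : 2 * (n / 4) < n := by omega
  obtain ⟨lam, hlam, hA𝔸⟩ := hwin
  obtain ⟨lam', hlam', hΦn⟩ := hΦw
  have hlam0 : 0 < lam := by linarith [hlam.1]
  have hlam'0 : 0 < lam' := by linarith [hlam'.1]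
  have hcν : 0 ≤ c / ν := div_nonneg hc.le hν0.le
  have hn2 : (0:ℝ) < 1 / (n:ℝ) ^ 2 := by positivity
  have hAΛ : Torus.NearIso 𝔸 (ν * (lo / Λ)) (ν * (hi * Λ)) :=
    hA𝔸.mono (mul_le_mul_of_nonneg_left (div_le_div_of_nonneg_left hlo.le hlam0 hlam.2) hν0.le)
      (mul_le_mul_of_nonneg_left (mul_le_mul_of_nonneg_left hlam.2 hhi0) hν0.le)
  have hloA : 0 < ν * (lo / Λ) := mul_pos hν0 (div_pos hlo hΛ0)
  have hcell : Torus.NearIso ((1 / (n:ℝ) ^ 2) • 𝔸) ((1 / (n:ℝ) ^ 2) * (ν * (lo / Λ))) ((1 / (n:ℝ) ^ 2) * (ν * (hi * Λ))) := hAΛ.smul hn2.le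
  have hcell_lo : 0 < (1 / (n:ℝ) ^ 2) * (ν * (lo / Λ)) := mul_pos hn2 hloA
  have hcoarse0 : Torus.NearIso ((1 / (n:ℝ) ^ 2) • (𝔸 + (c / ν) • Φ ν ((1 / ν) • 𝔸)))
      ((1 / (n:ℝ) ^ 2) * (ν * (lo / lam) + (c / ν) * (lo / lam'))) ((1 / (n:ℝ) ^ 2) * (ν * (hi * lam) + (c / ν) * (hi * lam'))) :=
    (hA𝔸.add (hΦn.smul hcν)).smul hn2.le
  have hloT_le : loT lo Λ c ν n ≤ (1 / (n:ℝ) ^ 2) * (ν * (lo / lam) + (c / ν) * (lo / lam')) := by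
    unfold loT
    have h1 : lo / Λ ≤ lo / lam := div_le_div_of_nonneg_left hlo.le hlam0 hlam.2
    have h2 : lo / Λ ≤ lo / lam' := div_le_div_of_nonneg_left hlo.le hlam'0 hlam'.2
    have h3 : (ν + c / ν) * (lo / Λ) ≤ ν * (lo / lam) + (c / ν) * (lo / lam') := by
      have := mul_le_mul_of_nonneg_left h1 hν0.le
      have := mul_le_mul_of_nonneg_left h2 hcν
      nlinarith
    exact mul_le_mul_of_nonneg_left h3 hn2.le
  have hloT : 0 < loT lo Λ c ν n := by
    unfold loT
    have hνc : 0 < ν + c / ν := by positivity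
    exact mul_pos hn2 (mul_pos hνc (div_pos hlo hΛ0))
  have hcoarse : Torus.NearIso ((1 / (n:ℝ) ^ 2) • (𝔸 + (c / ν) • Φ ν ((1 / ν) • 𝔸)))
      (loT lo Λ c ν n) ((1 / (n:ℝ) ^ 2) * (ν * (hi * lam) + (c / ν) * (hi * lam'))) := hcoarse0.mono hloT_le le_rfl
  set LT : ℝ := loT lo Λ c ν n with hLTdef
  have hbU : MemLp (Torus.stLift (cellField W M hM ν hν.1 n)) ∞ (volume.restrict (Ioo 0 Tw ×ˢ (univ : Set (EuclideanSpace ℝ (Fin 3))))) :=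
    memLp_top_stLift_cell _ n Tw
  have hbUdiv : ∀ᵐ τ ∂(volume.restrict (Ioo (0:ℝ) Tw)), Torus.IsWeaklyDivFree (cellField W M hM ν hν.1 n τ) :=
    ae_of_all _ fun τ => (isDivFree_cell _ n τ).isWeaklyDivFree_holds (isSmooth_cell _ n τ)
  have hgrid : ∀ (j : Fin 3 → Fin n) (τ : ℝ) (y : UnitAddTorus (Fin 3)),
      cellField W M hM ν hν.1 n τ (y + (fun i => ((((j i : ℕ) : ℝ) / n : ℝ) : UnitAddCircle))) = cellField W M hM ν hν.1 n τ y :=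
    fun j τ y => by unfold cellField; exact cell_add_grid _ hnpos j τ y
  have hUcl : ∀ (c' : Fin 3 → ℤ) (y : V2), (∀ k', ((∀ i, (n:ℤ) ∣ k' i - c' i) ∨ (∀ i, (n:ℤ) ∣ k' i + c' i)) →
        mFourierCoeff (EuclideanSpace.complexify ∘ ⇑y) k' = 0) →
      ∀ k', ((∀ i, (n:ℤ) ∣ k' i - c' i) ∨ (∀ i, (n:ℤ) ∣ k' i + c' i)) →
        mFourierCoeff (EuclideanSpace.complexify ∘ ⇑(U s t y)) k' = 0 :=
    fun c' y hy k' hk' => PropagatorSymm.fcoeff_apply_eq_zero_of_classes hU hcell hcell_lo hbU hbUdiv hnpos hgrid c' hs hst.le htT y hy k' hk'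
  have hTmode : ∀ (y : V2) (k' : Fin 3 → ℤ), mFourierCoeff (EuclideanSpace.complexify ∘ ⇑y) k' = 0 →
      mFourierCoeff (EuclideanSpace.complexify ∘ ⇑(T s t y)) k' = 0 :=
    fun y k' hk' => fc_propagator_eq_zero hcoarse hloT (fun _ _ => rfl) hT hs hst.le htT y hk'
  have halone : ∀ ℓ ∈ S, ∀ k' ∈ S, ((∀ i, (n:ℤ) ∣ k' i - ℓ i) ∨ (∀ i, (n:ℤ) ∣ k' i + ℓ i)) → k' = ℓ ∨ k' = -ℓ :=
    fun ℓ hℓ k' hk' hpair => FlatWindow.alone_of_lt hLN (Finset.mem_of_mem_erase (hSsub ℓ hℓ)) (Finset.mem_of_mem_erase (hSsub k' hk')) hpair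
  have hnsc : ∀ ℓ ∈ S, ¬ (∀ i, (n:ℤ) ∣ ℓ i + ℓ i) :=
    fun ℓ hℓ => FlatWindow.not_selfConj_of_lt hLN (Finset.mem_of_mem_erase (hSsub ℓ hℓ)) (Finset.ne_of_mem_erase (hSsub ℓ hℓ))
  have hSneg : ∀ k' ∈ S, -k' ∈ S := fun k' hk' => by
    have hk'e := hSsub k' hk'
    refine Finset.mem_filter.2 ⟨Finset.mem_erase.2 ⟨neg_ne_zero.2 (Finset.ne_of_mem_erase hk'e),
      Torus.neg_mem_freqBall.2 (Finset.mem_of_mem_erase hk'e)⟩, ?_⟩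
    rw [Torus.latticeVec_neg, norm_neg]; exact hSL k' hk'
  -- the uniform leak `εH` and the weights
  set εH : ℝ := Real.sqrt CK * Real.exp (-(cK * ν * (t - s))) with hεH
  have hεH0 : 0 ≤ εH := by positivity
  set ε : (Fin 3 → ℤ) → ℝ := fun _ => εH with hεdef
  have hε0 : ∀ ℓ, 0 ≤ ε ℓ := fun _ => hεH0
  set dL : ℝ := 1 - Real.exp (-(8 * Real.pi ^ 2 * LT * L ^ 2 * (t - s))) with hdL
  have hdL0 : 0 < dL := by
    rw [hdL]
    have : Real.exp (-(8 * Real.pi ^ 2 * LT * L ^ 2 * (t - s))) < 1 := Real.exp_lt_one_iff.2 (by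
      have : 0 < 8 * Real.pi ^ 2 * LT * L ^ 2 * (t - s) := by positivity
      linarith)
    linarith
  set η : ℝ := εH / Real.sqrt dL with hηdef
  have hη0 : 0 ≤ η := by positivity
  set d : (Fin 3 → ℤ) → ℝ := fun ℓ => dW lo Λ c ν n (t - s) ℓ with hddef
  have hd0 : ∀ ℓ, 0 ≤ d ℓ := fun ℓ => by
    rw [hddef]; unfold dW
    have : Real.exp (-(8 * Real.pi ^ 2 * loT lo Λ c ν n * Torus.freqNormSq ℓ * (t - s))) ≤ 1 := by
      apply Real.exp_le_one_iff.2
      have := Torus.freqNormSq_nonneg ℓ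
      have : 0 ≤ 8 * Real.pi ^ 2 * loT lo Λ c ν n * Torus.freqNormSq ℓ * (t - s) := by positivity
      linarith
    linarith
  have hdLd : ∀ ℓ ∈ S, dL ≤ d ℓ := by
    intro ℓ hℓ
    rw [hdL, hddef]; unfold dW
    have hL2 : L ^ 2 ≤ Torus.freqNormSq ℓ := by
      rw [← Torus.norm_latticeVec_sq]
      exact pow_le_pow_left₀ hL.le (hSL ℓ hℓ) 2
    have hmono : 8 * Real.pi ^ 2 * LT * L ^ 2 * (t - s) ≤ 8 * Real.pi ^ 2 * loT lo Λ c ν n * Torus.freqNormSq ℓ * (t - s) := by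
      rw [hLTdef]
      have : 0 ≤ 8 * Real.pi ^ 2 * loT lo Λ c ν n * (t - s) := by positivity
      nlinarith
    have := Real.exp_le_exp.2 (neg_le_neg hmono)
    linarith
  have hεd : ∀ ℓ ∈ S, ε ℓ ≤ η * Real.sqrt (d ℓ) := by
    intro ℓ hℓ
    show εH ≤ εH / Real.sqrt dL * Real.sqrt (d ℓ)
    have hsd : Real.sqrt dL ≤ Real.sqrt (d ℓ) := Real.sqrt_le_sqrt (hdLd ℓ hℓ)
    have hsd0 : 0 < Real.sqrt dL := Real.sqrt_pos.2 hdL0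
    calc εH = εH / Real.sqrt dL * Real.sqrt dL := by field_simp
      _ ≤ εH / Real.sqrt dL * Real.sqrt (d ℓ) := mul_le_mul_of_nonneg_left hsd (by positivity)
  have hphase' := hphase
  have hleak : ∀ ℓ ∈ S, ∀ v : V2, v ∈ Torus.divFreeL2 (Fin 3) →
      (∀ k', ¬ ((∀ i, (n:ℤ) ∣ k' i - ℓ i) ∨ (∀ i, (n:ℤ) ∣ k' i + ℓ i)) → mFourierCoeff (EuclideanSpace.complexify ∘ ⇑v) k' = 0) →
      mFourierCoeff (EuclideanSpace.complexify ∘ ⇑v) ℓ = 0 → mFourierCoeff (EuclideanSpace.complexify ∘ ⇑v) (-ℓ) = 0 →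
      ‖mFourierCoeff (EuclideanSpace.complexify ∘ ⇑(U s t v)) ℓ‖ ≤ ε ℓ * ‖v‖ := by
    intro ℓ hℓ v hv hvs _ _
    have hℓball : ℓ ∈ Torus.freqBall (d := Fin 3) (n / 4) := Finset.mem_of_mem_erase (hSsub ℓ hℓ)
    have hℓn : 2 * ‖Torus.latticeVec ℓ‖ < n := by
      have h1 : ‖Torus.latticeVec ℓ‖ ≤ (N₄ : ℝ) := by
        rw [← Real.sqrt_sq (norm_nonneg (Torus.latticeVec ℓ)), Torus.norm_latticeVec_sq, ← Real.sqrt_sq (Nat.cast_nonneg N₄)]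
        exact Real.sqrt_le_sqrt (Torus.mem_freqBall.1 hℓball)
      have h2 : (2:ℝ) * N₄ < n := by exact_mod_cast hLN
      linarith
    exact norm_fc_le_of_highClass_fast W M hM hH hlo hhi0 hΛ1 hCK hνI hn1' hodd ⟨lam, hlam, hA𝔸⟩ hU hs hst.le htT hsT hphase' hL hKL
      (hSL ℓ hℓ) hℓn v hv hvs
  have hxS : ∀ k' ∈ S, mFourierCoeff (EuclideanSpace.complexify ∘ ⇑x) k' = 0 :=
    fun k' hk' => hx k' (Finset.mem_of_mem_erase (hSsub k' hk'))
  have hζS : ∀ k', k' ∉ S → mFourierCoeff (EuclideanSpace.complexify ∘ ⇑ζ) k' = 0 := by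
    intro k' hk'
    by_cases hball : k' ∈ Torus.freqBall (d := Fin 3) (n / 4)
    · by_cases hk0 : k' = 0
      · rw [hk0]; exact hζH 0 (by rw [Torus.latticeVec_zero, norm_zero]; exact hL)
      · have hlt : ‖Torus.latticeVec k'‖ < L := by
          by_contra hge
          exact hk' (Finset.mem_filter.2 ⟨Finset.mem_erase.2 ⟨hk0, hball⟩, (not_lt.1 hge)⟩)
        exact hζH k' hlt
    · exact hζ k' hball
  have key := abs_inner_sub_le_sqrt_of_fast_modewise S (U s t) (T s t) ε hnpos hSneg halone hnsc hε0
    (fun y => hU.apply_eq_apply_starProjection s t y) (fun y => hT.apply_eq_apply_starProjection s t y)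
    hUcl hTmode hleak d η hη0 hd0 hεd x ζ hxS hζS
  have hAζ : ∑ k' ∈ S, d k' * ‖mFourierCoeff (EuclideanSpace.complexify ∘ ⇑ζ) k'‖ ^ 2 ≤ lossAdj (T s t) ζ :=
    sum_weight_le_lossAdj hcoarse hloT hT hs hst.le htT S ζ
  have hFx : (1 / 2) * ‖x‖ ^ 2 ≤ lossFwd (T s t) x := by
    have hsupp : ∀ k', fc x k' ≠ 0 → ((N₄ : ℝ)) ^ 2 ≤ Torus.freqNormSq k' := by
      intro k' hk'
      by_contra hlt
      exact hk' (hx k' (Torus.mem_freqBall.2 (le_of_lt (not_le.1 hlt))))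
    have h := lossFwd_ge_of_supp hcoarse hloT (fun _ _ => rfl) hT hs hst.le htT x (sq_nonneg (N₄ : ℝ)) hsupp
    have he : (1:ℝ) / 2 ≤ 1 - Real.exp (-(8 * Real.pi ^ 2 * LT * (N₄:ℝ) ^ 2 * (t - s))) := half_le_one_sub_exp_neg_of_one_le hsat
    exact (mul_le_mul_of_nonneg_right he (sq_nonneg _)).trans h
  have hxle : ‖x‖ ≤ Real.sqrt 2 * Real.sqrt (lossFwd (T s t) x) := by
    rw [← Real.sqrt_mul (by norm_num)]
    calc ‖x‖ = Real.sqrt (‖x‖ ^ 2) := (Real.sqrt_sq (norm_nonneg _)).symm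
      _ ≤ Real.sqrt (2 * lossFwd (T s t) x) := Real.sqrt_le_sqrt (by linarith)
  refine key.trans ?_
  have hs2 : Real.sqrt 2 * Real.sqrt 2 = 2 := Real.mul_self_sqrt (by norm_num)
  calc Real.sqrt 2 * η * ‖x‖ * Real.sqrt (∑ k' ∈ S, d k' * ‖mFourierCoeff (EuclideanSpace.complexify ∘ ⇑ζ) k'‖ ^ 2)
      ≤ Real.sqrt 2 * η * (Real.sqrt 2 * Real.sqrt (lossFwd (T s t) x)) * Real.sqrt (lossAdj (T s t) ζ) :=
        mul_le_mul (mul_le_mul_of_nonneg_left hxle (by positivity)) (Real.sqrt_le_sqrt hAζ) (Real.sqrt_nonneg _) (by positivity)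
    _ = 2 * η * Real.sqrt (lossFwd (T s t) x) * Real.sqrt (lossAdj (T s t) ζ) := by
        rw [show Real.sqrt 2 * η * (Real.sqrt 2 * Real.sqrt (lossFwd (T s t) x)) = (Real.sqrt 2 * Real.sqrt 2) * η * Real.sqrt (lossFwd (T s t) x) by ring, hs2]

end Summit.AnomalousDissipation.AnomalousDissipation.Theorems.SolenoidalFractalHomogenisation.LagrangianStep.VmodFlat

end
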